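import Summits.HodgeConjecture.HodgeConjecture.Theorems.K2E3AbelianLayerClifford   -- ★ p855708 (this seat): Clifford one-orbit + docking; brings ★ p855655 eigencharacters
import HarnessLib

/-!
# Crux `H413` — K2-LIT E3 «EllipticInputs», U12-h: THE CHARACTERS OF AN ABELIAN LAYER ON A `K₁`-TYPE — the five facts the depth-halving argument uses, stated on
# Harish-Chandra's data `(W = V^{K′}, Q, φ, τ, c)` of ★ p855602 (HF) for a layer `A ≤ K₁` acting commutatively on the type `c`

Cell `hodgecm-mathlib`, Track B «K2-LIT», crux item `stmt-HodgeConjecture-24833` (h413), line `K2_E3_EllipticInputs`, unit U12 «HC characters», socket U12-h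
`sig_K2E3CharLocConstNearRegular` (‹#9L›).  Seat K2E3-p09 (g2), 9L line lead; first half of brick (It) of memo v4 `K2/K2E3-p09/g2/MEMO-U12h-HF-bricks.v4.K2E3-p09-g2.md` (depth-halving road,
K2E1b-p08 (g2) MEMO (H2) d8755e6223fd3317 §1 (C1)); `--supports stmt-HodgeConjecture-24833 --as helper`.  THEOREMS ONLY — no `def`, no named fact, no instance, no notation, no `sorry`.
GENERIC: `k` algebraically closed of characteristic `0`; a group `G` (no topology); a finite-dimensional `k`-space `W` with operators `L : G → End W`; `K₁ ≤ G`, a finite group `Q`,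
`φ : K₁ ↠ Q`, `τ : Q → GL(W)` with `τ(φ x) = L x` (★ p855420's shape); an isotypic component `c` of `W` under `k[Q]` (★ L2″ ∕ HF); a subgroup `A ≤ K₁` normalised by `K₁` whose operators
COMMUTE ON `c`.  HONEST LABEL: HC_CM is proved only modulo the 7 printed citations (2 remaining named inputs: hLiu418 = stmt-HodgeConjecture-24832, h413 = stmt-HodgeConjecture-24833) until
rung 0 closes; count-neutral engine.

THE MATHEMATICS.  A character `χ : G → k` OCCURS (in `c`, on the layer `A`) when some non-zero `w ∈ c` has `L_a w = χ(a) w` for all `a ∈ A`.  Restricting the commuting finite-order family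
`(L_a|_c)_{a ∈ A}` to the `k`-space underlying `c` (★ p855655) and the isotypic `Q`-representation on `c` (★ p855708 §3), the abstract statements of ★ p855655 ∕ ★ p855708 become:
* §1 `apply_mul_eq_of_occurs`, `apply_eq_one_of_occurs_of_forall` — occurring characters are multiplicative on `A` and trivial on the elements of `A` acting trivially on `c`.
* §2 **`exists_occurs_pair_of_intertwiner`** — (INT) of HF («`y` intertwines the type»: `T ≠ 0` on `c`, `T(W) ⊆ c`, `L_z T = T L_{y⁻¹zy}` for `z ∈ K₁ ∩ yK₁y⁻¹`) ⇒ occurring `χ₁, χ₂`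
  with `χ₂(a) = χ₁(y⁻¹ a y)` on `A ∩ y A y⁻¹` [HarishChandra1999, p. 85; the input of ★ (H3-lite) p855559 (C)].
* §3 **`exists_occurs_trivial_of_fixed`** — (OCC) of HF (a non-zero `w ∈ c` fixed by `K₁ ∩ x K₀′ x⁻¹`) ⇒ an occurring `χ` trivial on `A ∩ x K₀′ x⁻¹` [HC Def. 15.1; the input of ★ (N) p855641].
* §4 **`exists_occurs_ne_one_of_ne`**, **`forall_apply_eq_self_of_forall_occurs`** — DEPTH: `A′ ⊆ A` acts non-trivially on `c` iff some occurring `χ` is non-trivial on `A′`.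
* §5 **`exists_conj_of_occurs_of_occurs` — ONE ORBIT** (Clifford, ★ p855708): two occurring characters are `K₁`-conjugate: `χ′(a) = χ(x⁻¹ a x)` (`a ∈ A`) for some `x ∈ K₁`.
With these, the depth-halving endgame (memo v4 §1 (C2)–(C4)) only manipulates characters `χ : G → k` of the layers `A = K_{N′}`, their parameters `X` (★ (S) p855619) and norms (★ L6).

## References
* [HarishChandra1999] Harish-Chandra (notes by S. DeBacker and P. J. Sally, Jr.), *Admissible Invariant Distributions on Reductive p-adic Groups*, ULECT 16, AMS (1999): §15 Def. 15.1, §17,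
  Lemmas 19.2–19.4, pp. 84–86.
* [Serre1977] J.-P. Serre, *Linear Representations of Finite Groups*, GTM 42 (1977): §8.1 Prop. 24.
-/

set_option autoImplicit false
-- the mandated namespace repeats `HodgeConjecture.HodgeConjecture`, as in every `Theorems/*.lean` of this sub-problem
set_option linter.dupNamespace false

noncomputable section

open Module Set
open Summit.HodgeConjecture.HodgeConjecture.Cruxes.H413.K2E3AbelianLayerEigencharacters
open Summit.HodgeConjecture.HodgeConjecture.Cruxes.H413.K2E3AbelianLayerClifford

namespace Summit.HodgeConjecture.HodgeConjecture.Cruxes.H413.K2E3TypeLayerCharacters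

variable {k G W Q : Type*} [Field k] [IsAlgClosed k] [CharZero k] [Group G] [AddCommGroup W] [Module k W] [FiniteDimensional k W] [Group Q] [Finite Q]
  (L : G → Module.End k W) {K₁ A : Subgroup G} (φ : ↥K₁ →* Q) (τ : Representation k Q W) (c : Submodule (MonoidAlgebra k Q) τ.asModule)

/-! ## §0 The layer family on the `k`-space underlying `c` -/

section Family

omit [IsAlgClosed k] [CharZero k] [FiniteDimensional k W] [Finite Q] in
/-- `L_a` (`a ∈ A ≤ K₁`) maps `c` into `c` (`L_a = τ(φ a)` and `c` is a `k[Q]`-submodule). [cite: Serre1977, §8.1 Prop. 24] -/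
theorem apply_mem_of_mem (hτ : ∀ x : ↥K₁, τ (φ x) = L x) (hA : A ≤ K₁) (a : ↥A) {w : W} (hw : τ.asModuleEquiv.symm w ∈ c) : τ.asModuleEquiv.symm (L a w) ∈ c := by
  rw [← hτ ⟨a, hA a.2⟩]
  exact (Subrepresentation.ofSubmodule' c).apply_mem_toSubmodule (φ ⟨a, hA a.2⟩) hw

omit [IsAlgClosed k] [CharZero k] [FiniteDimensional k W] [Finite Q] in
/-- The layer operators are multiplicative on `A`: `L_a L_b = L_{ab}`. [folklore] -/
theorem mul_eq_of_mem (hτ : ∀ x : ↥K₁, τ (φ x) = L x) (hA : A ≤ K₁) (a b : ↥A) : L a * L b = L ((a : G) * b) := by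
  rw [← hτ ⟨a, hA a.2⟩, ← hτ ⟨b, hA b.2⟩, ← hτ ⟨a * b, hA (A.mul_mem a.2 b.2)⟩, ← map_mul, ← map_mul]
  rfl

omit [IsAlgClosed k] [CharZero k] [FiniteDimensional k W] [Finite Q] in
/-- The layer operators have finite order: `L_a ^ |Q| = 1` (`Nat.card Q = 0` for infinite `Q` makes this vacuous-true there). [folklore] -/
theorem pow_card_eq_one_of_mem (hτ : ∀ x : ↥K₁, τ (φ x) = L x) (hA : A ≤ K₁) (a : ↥A) : L a ^ Nat.card Q = 1 := by
  rw [← hτ ⟨a, hA a.2⟩, ← map_pow, pow_card_eq_one', map_one]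

end Family

/-! ## §1 Occurring characters are characters -/

section Character

omit [IsAlgClosed k] [CharZero k] [FiniteDimensional k W] [Finite Q] in
/-- **An occurring character is multiplicative on the layer**: `w ≠ 0`, `L_a w = χ(a) w` (`a ∈ A`) ⇒ `χ(ab) = χ(a) χ(b)` for `a, b ∈ A`. [cite: Serre1977, §8.1 Prop. 24] -/
theorem apply_mul_eq_of_occurs (hτ : ∀ x : ↥K₁, τ (φ x) = L x) (hA : A ≤ K₁) {χ : G → k} {w : W} (hw0 : w ≠ 0) (hχ : ∀ a ∈ A, L a w = χ a • w)
    {a b : G} (ha : a ∈ A) (hb : b ∈ A) : χ (a * b) = χ a * χ b := by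
  have h := mul_eq_of_mem L φ τ hτ hA ⟨a, ha⟩ ⟨b, hb⟩
  have h1 : L (a * b) w = (χ a * χ b) • w := by
    rw [show L (a * b) = L a * L b from h.symm, Module.End.mul_apply, hχ b hb, map_smul, hχ a ha, smul_smul, mul_comm]
  rw [hχ (a * b) (A.mul_mem ha hb)] at h1
  exact smul_left_injective k hw0 h1

omit [IsAlgClosed k] [CharZero k] [FiniteDimensional k W] [Finite Q] in
/-- **An occurring character is `1` on the elements of the layer acting trivially on `c`** (e.g. on `K_N` for a type of depth `N`). [cite: HarishChandra1999, §19 Cor. 19.5] -/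
theorem apply_eq_one_of_occurs_of_forall {χ : G → k} {w : W} (hwc : τ.asModuleEquiv.symm w ∈ c) (hw0 : w ≠ 0) (hχ : ∀ a ∈ A, L a w = χ a • w)
    {a : G} (ha : a ∈ A) (htriv : ∀ v : W, τ.asModuleEquiv.symm v ∈ c → L a v = v) : χ a = 1 := by
  have h := hχ a ha
  rw [htriv w hwc] at h
  exact (smul_left_injective k hw0 (show (1 : k) • w = χ a • w by rw [one_smul]; exact h)).symm

end Character

/-! ## §2–§5 The restricted family and the four existence statements -/

section Occurrence

omit [IsAlgClosed k] [CharZero k] [FiniteDimensional k W] [Finite Q] in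
/-- Technical heart: every conclusion of ★ p855655 ∕ ★ p855708 about the restricted family `a ↦ L_a|_c` on the `k`-space underlying `c` yields an OCCURRING character `G → k`.  Precisely:
if the simultaneous eigenspace of the restricted family for `χ : ↥A → k` is non-zero, then the extension of `χ` by `1` off `A` occurs. [cite: Serre1977, §8.1 Prop. 24] -/
theorem exists_occurs_of_ne_bot [DecidablePred (· ∈ A)] (hτ : ∀ x : ↥K₁, τ (φ x) = L x) (hA : A ≤ K₁) {χ : ↥A → k}
    (hχ : (⨅ a : ↥A, Module.End.eigenspace ((L (a : G)).restrict (fun _ hw => apply_mem_of_mem L φ τ c hτ hA a hw) :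
        Module.End k ↥((Submodule.restrictScalars k c).comap τ.asModuleEquiv.symm.toLinearMap)) (χ a)) ≠ ⊥) :
    ∃ w : W, τ.asModuleEquiv.symm w ∈ c ∧ w ≠ 0 ∧ ∀ a (ha : a ∈ A), L a w = (fun z => if hz : z ∈ A then χ ⟨z, hz⟩ else 1) a • w := by
  obtain ⟨v, hv, hv0⟩ := Submodule.exists_mem_ne_zero_of_ne_bot hχ
  refine ⟨(v : W), v.2, fun h => hv0 (Subtype.ext h), fun a ha => ?_⟩
  have h := congrArg Subtype.val (apply_eq_smul_of_mem_iInf_eigenspace _ hv ⟨a, ha⟩)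
  simp only [LinearMap.coe_restrict_apply, Submodule.coe_smul] at h
  simp only [dif_pos ha]
  exact h

/-- **(INT) ⇒ A MATCHING PAIR OF OCCURRING CHARACTERS.**  If `y` intertwines the type (HF's INT: `T ≠ 0` on `c`, `T(W) ⊆ c`, `L_z ∘ T = T ∘ L_{y⁻¹ z y}` for `z ∈ K₁ ∩ y K₁ y⁻¹`) and the layer
`A ≤ K₁` (normalised by `K₁`) acts commutatively on `c`, then there are occurring characters `χ₁, χ₂` with `χ₂(a) = χ₁(y⁻¹ a y)` for every `a ∈ A` with `y⁻¹ a y ∈ A`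
(★ p855655 `exists_pair_of_twisted_intertwiner`). [cite: HarishChandra1999, p. 85] [cite: Serre1977, §8.1 Prop. 24] -/
theorem exists_occurs_pair_of_intertwiner (hτ : ∀ x : ↥K₁, τ (φ x) = L x) (hA : A ≤ K₁)
    (hcomm : ∀ a ∈ A, ∀ b ∈ A, ∀ w : W, τ.asModuleEquiv.symm w ∈ c → L a (L b w) = L b (L a w)) {y : G} {T : Module.End k W}
    (hTc : ∀ v, τ.asModuleEquiv.symm (T v) ∈ c) (hT0 : ∃ u, τ.asModuleEquiv.symm u ∈ c ∧ T u ≠ 0)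
    (hTint : ∀ z ∈ K₁, y⁻¹ * z * y ∈ K₁ → L z * T = T * L (y⁻¹ * z * y)) :
    ∃ χ₁ χ₂ : G → k, (∃ w, τ.asModuleEquiv.symm w ∈ c ∧ w ≠ 0 ∧ ∀ a ∈ A, L a w = χ₁ a • w) ∧ (∃ w, τ.asModuleEquiv.symm w ∈ c ∧ w ≠ 0 ∧ ∀ a ∈ A, L a w = χ₂ a • w) ∧
      ∀ a ∈ A, y⁻¹ * a * y ∈ A → χ₂ a = χ₁ (y⁻¹ * a * y) := by
  classical
  let cW : Submodule k W := (Submodule.restrictScalars k c).comap τ.asModuleEquiv.symm.toLinearMap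
  let f : ↥A → Module.End k cW := fun a => (L (a : G)).restrict (fun _ hw => apply_mem_of_mem L φ τ c hτ hA a hw)
  have hfcomm : ∀ a b, Commute (f a) (f b) := fun a b =>
    LinearMap.ext fun w => Subtype.ext (by simpa only [f, Module.End.mul_apply, LinearMap.coe_restrict_apply] using hcomm a a.2 b b.2 w w.2)
  have hffin : ∀ a, ∃ n : ℕ, 0 < n ∧ f a ^ n = 1 := fun a => ⟨Nat.card Q, Nat.card_pos, by
    simp only [f]
    rw [Module.End.pow_restrict]
    exact LinearMap.ext fun w => Subtype.ext (by rw [LinearMap.coe_restrict_apply, pow_card_eq_one_of_mem L φ τ hτ hA a, Module.End.one_apply, Module.End.one_apply])⟩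
  -- the intertwiner restricted to `c`
  let T' : Module.End k cW := T.restrict (p := cW) (q := cW) (fun v _ => hTc v)
  have hT'0 : T' ≠ 0 := by
    obtain ⟨u, huc, hu⟩ := hT0
    intro h
    apply hu
    have := congrArg Subtype.val (LinearMap.congr_fun h ⟨u, huc⟩)
    simpa only [T', LinearMap.coe_restrict_apply, LinearMap.zero_apply, ZeroMemClass.coe_zero] using this
  let θ : ↥A → ↥A := fun a => if h : y⁻¹ * a * y ∈ A then ⟨y⁻¹ * a * y, h⟩ else a
  have htw : ∀ a ∈ {a : ↥A | y⁻¹ * (a : G) * y ∈ A}, f a * T' = T' * f (θ a) := fun a ha => by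
    have hθ : ((θ a : ↥A) : G) = y⁻¹ * a * y := by simp only [θ, dif_pos (show y⁻¹ * (a : G) * y ∈ A from ha)]
    refine LinearMap.ext fun w => Subtype.ext ?_
    simp only [f, T', Module.End.mul_apply, LinearMap.coe_restrict_apply, hθ]
    exact LinearMap.congr_fun (hTint a (hA a.2) (hA ha)) (w : W)
  obtain ⟨χ₁, χ₂, h₁, h₂, h12⟩ := exists_pair_of_twisted_intertwiner f hfcomm hffin θ hT'0 htw
  obtain ⟨w₁, hw₁c, hw₁0, hw₁⟩ := exists_occurs_of_ne_bot L φ τ c hτ hA h₁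
  obtain ⟨w₂, hw₂c, hw₂0, hw₂⟩ := exists_occurs_of_ne_bot L φ τ c hτ hA h₂
  refine ⟨_, _, ⟨w₁, hw₁c, hw₁0, hw₁⟩, ⟨w₂, hw₂c, hw₂0, hw₂⟩, fun a ha hya => ?_⟩
  have h := h12 ⟨a, ha⟩ hya
  simp only [θ, dif_pos hya] at h
  simp only [dif_pos ha, dif_pos hya]
  exact h

/-- **(OCC) ⇒ AN OCCURRING CHARACTER TRIVIAL ON `A ∩ x K₀′ x⁻¹`.**  A non-zero `w ∈ c` fixed by `L_z` for all `z ∈ K₁` with `x⁻¹ z x ∈ K₀′` (HF's OCC, ★ L4) yields an occurring character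
`χ` with `χ(a) = 1` for every `a ∈ A` with `x⁻¹ a x ∈ K₀′` (★ p855655 `exists_ne_bot_of_forall_apply_eq_self`). [cite: HarishChandra1999, §15 Def. 15.1 and p. 84 (1)] -/
theorem exists_occurs_trivial_of_fixed (hτ : ∀ x : ↥K₁, τ (φ x) = L x) (hA : A ≤ K₁)
    (hcomm : ∀ a ∈ A, ∀ b ∈ A, ∀ w : W, τ.asModuleEquiv.symm w ∈ c → L a (L b w) = L b (L a w)) {K₀' : Subgroup G} {x : G} {w : W}
    (hwc : τ.asModuleEquiv.symm w ∈ c) (hw0 : w ≠ 0) (hfix : ∀ z ∈ K₁, x⁻¹ * z * x ∈ K₀' → L z w = w) :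
    ∃ χ : G → k, (∃ w, τ.asModuleEquiv.symm w ∈ c ∧ w ≠ 0 ∧ ∀ a ∈ A, L a w = χ a • w) ∧ ∀ a ∈ A, x⁻¹ * a * x ∈ K₀' → χ a = 1 := by
  classical
  let cW : Submodule k W := (Submodule.restrictScalars k c).comap τ.asModuleEquiv.symm.toLinearMap
  let f : ↥A → Module.End k cW := fun a => (L (a : G)).restrict (fun _ hw => apply_mem_of_mem L φ τ c hτ hA a hw)
  have hfcomm : ∀ a b, Commute (f a) (f b) := fun a b =>
    LinearMap.ext fun w => Subtype.ext (by simpa only [f, Module.End.mul_apply, LinearMap.coe_restrict_apply] using hcomm a a.2 b b.2 w w.2)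
  have hffin : ∀ a, ∃ n : ℕ, 0 < n ∧ f a ^ n = 1 := fun a => ⟨Nat.card Q, Nat.card_pos, by
    simp only [f]
    rw [Module.End.pow_restrict]
    exact LinearMap.ext fun w => Subtype.ext (by rw [LinearMap.coe_restrict_apply, pow_card_eq_one_of_mem L φ τ hτ hA a, Module.End.one_apply, Module.End.one_apply])⟩
  have hv0 : (⟨w, hwc⟩ : cW) ≠ 0 := fun h => hw0 (congrArg Subtype.val h)
  obtain ⟨χ, hχ, hχS⟩ := exists_ne_bot_of_forall_apply_eq_self f hfcomm hffin (S := {a : ↥A | x⁻¹ * (a : G) * x ∈ K₀'}) hv0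
    fun a ha => Subtype.ext (by simpa only [f, LinearMap.coe_restrict_apply] using hfix a (hA a.2) ha)
  obtain ⟨w', hw'c, hw'0, hw'⟩ := exists_occurs_of_ne_bot L φ τ c hτ hA hχ
  refine ⟨_, ⟨w', hw'c, hw'0, hw'⟩, fun a ha hxa => ?_⟩
  simp only [dif_pos ha]
  exact hχS ⟨a, ha⟩ hxa

/-- **DEPTH, ⇒: if some `a ∈ A′ ⊆ A` acts non-trivially on `c` then an occurring character is non-trivial on `A′`** (★ p855655 `exists_ne_bot_apply_ne_one`).
[cite: HarishChandra1999, §19 Cor. 19.5] -/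
theorem exists_occurs_ne_one_of_ne (hτ : ∀ x : ↥K₁, τ (φ x) = L x) (hA : A ≤ K₁)
    (hcomm : ∀ a ∈ A, ∀ b ∈ A, ∀ w : W, τ.asModuleEquiv.symm w ∈ c → L a (L b w) = L b (L a w)) {a : G} (ha : a ∈ A)
    (hne : ∃ w : W, τ.asModuleEquiv.symm w ∈ c ∧ L a w ≠ w) :
    ∃ χ : G → k, (∃ w, τ.asModuleEquiv.symm w ∈ c ∧ w ≠ 0 ∧ ∀ b ∈ A, L b w = χ b • w) ∧ χ a ≠ 1 := by
  classical
  let cW : Submodule k W := (Submodule.restrictScalars k c).comap τ.asModuleEquiv.symm.toLinearMap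
  let f : ↥A → Module.End k cW := fun a => (L (a : G)).restrict (fun _ hw => apply_mem_of_mem L φ τ c hτ hA a hw)
  have hfcomm : ∀ a b, Commute (f a) (f b) := fun a b =>
    LinearMap.ext fun w => Subtype.ext (by simpa only [f, Module.End.mul_apply, LinearMap.coe_restrict_apply] using hcomm a a.2 b b.2 w w.2)
  have hffin : ∀ a, ∃ n : ℕ, 0 < n ∧ f a ^ n = 1 := fun a => ⟨Nat.card Q, Nat.card_pos, by
    simp only [f]
    rw [Module.End.pow_restrict]
    exact LinearMap.ext fun w => Subtype.ext (by rw [LinearMap.coe_restrict_apply, pow_card_eq_one_of_mem L φ τ hτ hA a, Module.End.one_apply, Module.End.one_apply])⟩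
  have hfa : f ⟨a, ha⟩ ≠ 1 := by
    obtain ⟨w, hwc, hw⟩ := hne
    intro h
    apply hw
    have := congrArg Subtype.val (LinearMap.congr_fun h ⟨w, hwc⟩)
    simpa only [f, LinearMap.coe_restrict_apply, Module.End.one_apply] using this
  obtain ⟨χ, hχ, hχa⟩ := exists_ne_bot_apply_ne_one f hfcomm hffin hfa
  obtain ⟨w', hw'c, hw'0, hw'⟩ := exists_occurs_of_ne_bot L φ τ c hτ hA hχ
  refine ⟨_, ⟨w', hw'c, hw'0, hw'⟩, ?_⟩
  simp only [dif_pos ha]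
  exact hχa

/-- **DEPTH, ⇐: if every occurring character is trivial on `a ∈ A` then `a` acts trivially on `c`** (★ p855655 `eq_one_of_forall_ne_bot_apply_eq_one`; contrapositive of
`exists_occurs_ne_one_of_ne`). [cite: HarishChandra1999, §19 Cor. 19.5] -/
theorem forall_apply_eq_self_of_forall_occurs (hτ : ∀ x : ↥K₁, τ (φ x) = L x) (hA : A ≤ K₁)
    (hcomm : ∀ a ∈ A, ∀ b ∈ A, ∀ w : W, τ.asModuleEquiv.symm w ∈ c → L a (L b w) = L b (L a w)) {a : G} (ha : a ∈ A)
    (h : ∀ χ : G → k, (∃ w, τ.asModuleEquiv.symm w ∈ c ∧ w ≠ 0 ∧ ∀ b ∈ A, L b w = χ b • w) → χ a = 1) :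
    ∀ w : W, τ.asModuleEquiv.symm w ∈ c → L a w = w := by
  by_contra hne
  push Not at hne
  obtain ⟨w, hwc, hw⟩ := hne
  obtain ⟨χ, hχ, hχa⟩ := exists_occurs_ne_one_of_ne L φ τ c hτ hA hcomm ha ⟨w, hwc, hw⟩
  exact hχa (h χ hχ)

/-- **ONE ORBIT (Clifford): two occurring characters of the layer `A` on the `K₁`-type `c` are `K₁`-conjugate** — `χ′(a) = χ(x⁻¹ a x)` for all `a ∈ A`, for some `x ∈ K₁` — provided `c` is an
isotypic component of `W` under `k[Q]`, `φ : K₁ ↠ Q`, and `A` is normalised by `K₁` (★ p855708 `exists_eq_comp_symm_of_ne_bot` on the restricted representation, ★ docking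
`isIsotypic_asModule_toRepresentation_ofSubmodule'`).  In the application this puts the parameters of ALL occurring characters of `A = K_{N′}` into one `Ad(K₁)`-orbit.
[cite: Serre1977, §8.1 Prop. 24] [cite: HarishChandra1999, §17 Thm. 17.1 and p. 85] -/
theorem exists_conj_of_occurs_of_occurs (hτ : ∀ x : ↥K₁, τ (φ x) = L x) (hφ : Function.Surjective φ) (hA : A ≤ K₁) (hnA : ∀ x ∈ K₁, ∀ a ∈ A, x * a * x⁻¹ ∈ A)
    (hc : c ∈ isotypicComponents (MonoidAlgebra k Q) τ.asModule)
    (hcomm : ∀ a ∈ A, ∀ b ∈ A, ∀ w : W, τ.asModuleEquiv.symm w ∈ c → L a (L b w) = L b (L a w)) {χ χ' : G → k}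
    (hχ : ∃ w, τ.asModuleEquiv.symm w ∈ c ∧ w ≠ 0 ∧ ∀ a ∈ A, L a w = χ a • w) (hχ' : ∃ w, τ.asModuleEquiv.symm w ∈ c ∧ w ≠ 0 ∧ ∀ a ∈ A, L a w = χ' a • w) :
    ∃ x ∈ K₁, ∀ a ∈ A, χ' a = χ (x⁻¹ * a * x) := by
  classical
  -- conjugation of `K₁` on `A` as a permutation representation
  have hnA' : ∀ x ∈ K₁, ∀ a ∈ A, x⁻¹ * a * x ∈ A := fun x hx a ha => by
    have := hnA x⁻¹ (K₁.inv_mem hx) a ha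
    rwa [inv_inv] at this
  let π : ↥K₁ →* Equiv.Perm ↥A :=
    { toFun := fun x =>
        { toFun := fun a => ⟨(x : G) * a * (x : G)⁻¹, hnA x x.2 a a.2⟩
          invFun := fun a => ⟨(x : G)⁻¹ * a * x, hnA' x x.2 a a.2⟩
          left_inv := fun a => Subtype.ext (by simp only [mul_assoc, inv_mul_cancel_left, inv_mul_cancel, mul_one])
          right_inv := fun a => Subtype.ext (by simp only [mul_assoc, mul_inv_cancel_left, mul_inv_cancel, mul_one]) }
      map_one' := Equiv.ext fun a => Subtype.ext (by simp)
      map_mul' := fun x y => Equiv.ext fun a => Subtype.ext (by simp [mul_assoc]) }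
  have hπsymm : ∀ (x : ↥K₁) (a : ↥A), (((π x).symm a : ↥A) : G) = (x : G)⁻¹ * a * x := fun x a => rfl
  -- the restricted representation on `c` and the layer
  let σ' := (Subrepresentation.ofSubmodule' c).toRepresentation
  have hiso := isIsotypic_asModule_toRepresentation_ofSubmodule' τ hc
  let s : ↥A → Q := fun a => φ ⟨a, hA a.2⟩
  have hconj : ∀ (x : ↥K₁) (a : ↥A), φ x * s a * (φ x)⁻¹ = s (π x a) := fun x a => by
    simp only [s, ← map_mul, ← map_inv]
    rfl
  have hσL : ∀ (a : ↥A) (w : (Subrepresentation.ofSubmodule' c).toSubmodule), ((σ' (s a) w : (Subrepresentation.ofSubmodule' c).toSubmodule) : W) = L a w :=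
    fun a w => by
      show τ (φ ⟨a, hA a.2⟩) w = L a w
      rw [hτ]
  have hσcomm : ∀ a b, Commute (σ' (s a)) (σ' (s b)) := fun a b =>
    LinearMap.ext fun w => Subtype.ext (by
      simp only [Module.End.mul_apply, hσL]
      exact hcomm a a.2 b b.2 w w.2)
  -- occurring characters give non-zero eigenspaces of the restricted family
  have hocc : ∀ {ξ : G → k}, (∃ w, τ.asModuleEquiv.symm w ∈ c ∧ w ≠ 0 ∧ ∀ a ∈ A, L a w = ξ a • w) →
      (⨅ a : ↥A, Module.End.eigenspace (σ' (s a)) (ξ a)) ≠ ⊥ := fun {ξ} ⟨w, hwc, hw0, hw⟩ => by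
    refine (Submodule.ne_bot_iff _).2 ⟨⟨w, hwc⟩, (Submodule.mem_iInf _).2 fun a => Module.End.mem_eigenspace_iff.2 (Subtype.ext ?_), fun h => hw0 (congrArg Subtype.val h)⟩
    rw [hσL, Submodule.coe_smul]
    exact hw a a.2
  obtain ⟨x, hx⟩ := exists_eq_comp_symm_of_ne_bot σ' s φ π hiso hφ hconj hσcomm (χ₁ := fun a : ↥A => χ a) (χ₂ := fun a : ↥A => χ' a) (hocc hχ) (hocc hχ')
  refine ⟨x, x.2, fun a ha => ?_⟩
  have h := congrFun hx ⟨a, ha⟩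
  simp only [Function.comp_apply, hπsymm] at h
  exact h

end Occurrence

end Summit.HodgeConjecture.HodgeConjecture.Cruxes.H413.K2E3TypeLayerCharacters

end
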